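import Summits.AtomisticToContinuum.BoseEinsteinCondensation.Theses.BECInfDivCoherence

/-!
# `Assembly` (item stmt-AtomisticToContinuum-9119 of route BECInfDivCoherence)

`Assembly := GridInfDivCoherence → LevyNegativeMoment → ScatteringLengthFinite →
GridAverageCondensate → LevyMassCondensation → BoundaryTransferWeak → BoseEinsteinCondensation`
(the audited sub-problem Statement decl `_root_.BoseEinsteinCondensation`, by name).

Pure logic. The glue `LevyMassCondensation` turns the two cruxes `GridInfDivCoherence`,
`LevyNegativeMoment` and the two supports `ScatteringLengthFinite`, `GridAverageCondensate` into
constant-mode condensation for near-minimisers of the periodic problem at every repulsive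
finite-range `v` — verbatim the antecedent of `BoundaryTransferWeak v` — and `BoundaryTransferWeak`
carries it to the Dirichlet, mode-free conjunct `HasGroundStateBEC v ρ` at all small densities,
which is `BoseEinsteinCondensation` unfolded. Equivalently: the route's deciding theorem `closes`
with its hypotheses permuted.
-/

namespace Summit.AtomisticToContinuum.BoseEinsteinCondensation.Theorems

open Summit.AtomisticToContinuum.BoseEinsteinCondensation.Theses.BECInfDivCoherence

/-- **`Assembly`** (item stmt-AtomisticToContinuum-9119 of route BECInfDivCoherence, concluded BY
NAME): `GridInfDivCoherence → LevyNegativeMoment → ScatteringLengthFinite → GridAverageCondensate →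
LevyMassCondensation → BoundaryTransferWeak → BoseEinsteinCondensation`. For a repulsive
finite-range `v`, `LevyMassCondensation` applied to the four preceding hypotheses yields periodic
constant-mode BEC at `v`, and `BoundaryTransferWeak v` turns that into
`∃ ρ₀ > 0, ∀ ρ ∈ (0, ρ₀), HasGroundStateBEC v ρ`. [folklore] -/
theorem becInfDivCoherence_assembly_proof :
    Summit.AtomisticToContinuum.BoseEinsteinCondensation.Theses.BECInfDivCoherence.Assembly := by
  unfold Summit.AtomisticToContinuum.BoseEinsteinCondensation.Theses.BECInfDivCoherence.Assembly
  intro h1 h2 h3 h4 h5 h6 v hv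
  exact h6 v hv (h5 h1 h2 h3 h4 v hv)

end Summit.AtomisticToContinuum.BoseEinsteinCondensation.Theorems
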